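import Mathlib
import Summits.QuantumFields.YangMills.Theorems.CurvatureSandwichBound.Negative.Unbundled
import Summits.QuantumFields.YangMills.Theorems.CurvatureSandwichBound.Negative.Inhabitants
import Summits.QuantumFields.YangMills.Theorems.MirrorModularBoostsPlanarSpectralCone
import Summits.QuantumFields.YangMills.Theorems.MirrorModularBoostsCurvatureBoostCovarianceRayPositivity
import Summits.QuantumFields.YangMills.Theorems.IsotropyFromPowerCountingCurvatureSandwichBoundChainEngine
import Summits.QuantumFields.YangMills.Theorems.IsotropyFromPowerCountingCurvatureSandwichBoundChainGrowthIff
import Summits.QuantumFields.YangMills.Theorems.IsotropyFromPowerCountingCurvatureSandwichBoundSumEngine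
import Summits.QuantumFields.YangMills.Theorems.IsotropyFromPowerCountingCurvatureSandwichBoundDescent
import Summits.QuantumFields.YangMills.Theorems.IsotropyFromPowerCountingCurvatureSandwichBoundGeneralWindow
import Summits.QuantumFields.YangMills.Theorems.IsotropyFromPowerCountingCurvatureSandwichBoundTiltedStep
import Summits.QuantumFields.YangMills.Theorems.IsotropyFromPowerCountingCurvatureSandwichBoundTiltedChainReading
import Summits.QuantumFields.YangMills.Theorems.IsotropyFromPowerCountingCurvatureSandwichBoundNarrowReduction

/-!
# `CurvatureSandwichBound` (Σ), line `Sketch` v4: THE 45° ROWS FOLLOW FROM THE AXIS ROWS (model-blind)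

`sandwichRows_quarterTurn_of_sandwichRows`: for EVERY one-species family with the OS package and translations on `⁰𝒮`,
the sandwich rows in the `e₀` frame (`SandwichRows S₁`) imply the sandwich rows of the quarter-turn pull-back
(`SandwichRows (S₁ ∘ R)`) — the 45° row of the crux is a corollary of its axis row.  Ingredients (all landed, all
model-blind): general windows, the tilted period, the tilted-chain reading, the sum engine, the descent, the narrow
reduction (skeleton v4 stubs) and the density of strict cone chains (`PositivityDiscToOperatorCone.stub_density`,
crux 9664) applied to `S₁ ∘ R`.  Corollary `curvatureSandwichBound_iff_axisRows`: the crux is EQUIVALENT to its axis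
row.  No lattice, no regularity, no diagonal transfer matrix.  Lead prover-line-stmt-QuantumFields-18372-c1-0.
-/

noncomputable section

namespace Summit.QuantumFields.YangMills.Theorems.CurvatureSandwichBound.Sketch

open scoped BigOperators SchwartzMap InnerProductSpace
open MeasureTheory Filter Topology
open Literature.MathematicalPhysics.QuantumLattice Literature.MathematicalPhysics.AQFT
  Literature.MathematicalPhysics.QuantumFieldTheory Literature.Probability.LatticeModels
open Summit.QuantumFields.YangMills.Theorems.NPointIsotropy.Negative (E4)
open Summit.QuantumFields.YangMills.Theorems.CurvatureBoostCovariance.Negative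
  (OSPackage Translations Hypercubic EightFrameRP PlanarCone Tie Gaps W1)
open Summit.QuantumFields.YangMills.Theorems.CurvatureSandwichBound.Negative
  (SandwichBound SandwichRows IsQuarterTurnFrame osReconstruction_of_osPackage curvatureSandwichBound_iff)
open Summit.QuantumFields.YangMills.Theorems.SoftKernelBoostCovariance.Negative (SoftKernel)
open Summit.QuantumFields.YangMills.Theorems.CurvatureBoostCovariance.BoostsInheritMirrors.RayPositivity
  (hasLinearGrowth_pullBack isSymmetric_pullBack)
open Summit.QuantumFields.YangMills.Cruxes.PlanarSpectralCone.PositivityDiscToOperatorCone (stub_density)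

/-- Raising the exponent of a sandwich bound (`u, v ≤ 1`). -/
theorem sandwichBound_mono_exponent {S : SchwingerFamily E4} {h : OSReconstructionNoE1 S.toLabelled}
    {μ μ' C : ℝ} (hSB : SandwichBound S h μ C) (hC : 0 ≤ C) (hμ : μ ≤ μ') : SandwichBound S h μ' C := by
  intro u v hu hv hu1 hv1 f₁ g hh Mg Mh Mh' hf₁ hg hgi hMg hhi hMh hMh' n W hW hFW
  refine (hSB u v hu hv hu1 hv1 f₁ g hh Mg Mh Mh' hf₁ hg hgi hMg hhi hMh hMh' n W hW hFW).trans ?_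
  have hMg0 : 0 ≤ Mg := (integral_nonneg fun _ => norm_nonneg _).trans hMg
  have hMh0 : 0 ≤ Mh := (integral_nonneg fun _ => norm_nonneg _).trans hMh
  have hMh'0 : 0 ≤ Mh' := (norm_nonneg _).trans (hMh' 0)
  have h1 : u ^ (-μ) ≤ u ^ (-μ') := Real.rpow_le_rpow_of_exponent_ge hu hu1 (neg_le_neg hμ)
  have h2 : v ^ (-μ) ≤ v ^ (-μ') := Real.rpow_le_rpow_of_exponent_ge hv hv1 (neg_le_neg hμ)
  have hK : 0 ≤ C * Mg * (Mh + Mh') := by positivity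
  exact mul_le_mul_of_nonneg_right (mul_le_mul_of_nonneg_left (add_le_add h1 h2) hK) (norm_nonneg _)

/-- Raising the constant of a sandwich bound. -/
theorem sandwichBound_mono_const {S : SchwingerFamily E4} {h : OSReconstructionNoE1 S.toLabelled}
    {μ C C' : ℝ} (hSB : SandwichBound S h μ C) (hC : C ≤ C') : SandwichBound S h μ C' := by
  intro u v hu hv hu1 hv1 f₁ g hh Mg Mh Mh' hf₁ hg hgi hMg hhi hMh hMh' n W hW hFW
  refine (hSB u v hu hv hu1 hv1 f₁ g hh Mg Mh Mh' hf₁ hg hgi hMg hhi hMh hMh' n W hW hFW).trans ?_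
  have hMg0 : 0 ≤ Mg := (integral_nonneg fun _ => norm_nonneg _).trans hMg
  have hMh0 : 0 ≤ Mh := (integral_nonneg fun _ => norm_nonneg _).trans hMh
  have hMh'0 : 0 ≤ Mh' := (norm_nonneg _).trans (hMh' 0)
  have hr : 0 ≤ u ^ (-μ) + v ^ (-μ) := add_nonneg (Real.rpow_nonneg hu.le _) (Real.rpow_nonneg hv.le _)
  have hK : 0 ≤ Mg * (Mh + Mh') * (u ^ (-μ) + v ^ (-μ)) * ‖h.fieldVec n (fun _ => ()) W hW‖ := by positivity
  calc C * Mg * (Mh + Mh') * (u ^ (-μ) + v ^ (-μ)) * ‖h.fieldVec n (fun _ => ()) W hW‖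
      = C * (Mg * (Mh + Mh') * (u ^ (-μ) + v ^ (-μ)) * ‖h.fieldVec n (fun _ => ()) W hW‖) := by ring
    _ ≤ C' * (Mg * (Mh + Mh') * (u ^ (-μ) + v ^ (-μ)) * ‖h.fieldVec n (fun _ => ()) W hW‖) :=
        mul_le_mul_of_nonneg_right hC hK
    _ = _ := by ring

/-- **The 45° rows from the axis rows** (frame transfer; skeleton v4 of line `Sketch`, lead c1): for every one-species
family with the OS package and translations on `⁰𝒮`, `SandwichRows S₁ → SandwichRows (S₁ ∘ R)` for the quarter-turn
frame `R`. -/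
theorem sandwichRows_quarterTurn_of_sandwichRows :
    ∀ (S₁ : SchwingerFamily E4), OSPackage S₁ → Translations S₁ → SandwichRows S₁ →
      ∀ (R : E4 ≃ₗᵢ[ℝ] E4), IsQuarterTurnFrame R → SandwichRows (fun n => (S₁ n).comp (linActMulti R)) := by
  intro S₁ hOS hT hrows R hRq h'
  -- the `e₀`-reconstruction of `S₁` and the axis row
  have h : OSReconstructionNoE1 S₁.toLabelled := osReconstruction_of_osPackage hOS hT
  obtain ⟨μ, C₀, hμ4, hSB₀⟩ := hrows h
  obtain ⟨C, hC⟩ : ∃ C : ℝ, C = max C₀ 0 := ⟨_, rfl⟩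
  have hC0 : 0 ≤ C := hC ▸ le_max_right _ _
  have hSB : SandwichBound S₁ h μ C := sandwichBound_mono_const hSB₀ (hC ▸ le_max_left _ _)
  -- raise the exponent to `μ' = max μ 0 ∈ [0, 4)` and pass to general windows
  obtain ⟨μ', hμ'⟩ : ∃ μ' : ℝ, μ' = max μ 0 := ⟨_, rfl⟩
  have hμ'0 : 0 ≤ μ' := hμ' ▸ le_max_right _ _
  have hμ'4 : μ' < 4 := hμ' ▸ max_lt hμ4 (by norm_num)
  have hSB' : SandwichBound S₁ h μ' C := sandwichBound_mono_exponent hSB hC0 (hμ' ▸ le_max_left _ _)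
  have hGW' := stub_generalWindow S₁ h μ' C hμ'0 hμ'4.le hC0 hSB'
  refine ⟨μ', 2048 * C, hμ'4, ?_⟩
  intro u v hu hv hu1 hv1 f₁ g hh Mg Mh Mh' hf₁ hg hgi hMg hhi hMh hMh'
  -- the 45° family and its `e₀`-reconstruction `h'`
  set S' : SchwingerFamily E4 := fun n => (S₁ n).comp (linActMulti R) with hS'
  have hlg' : (SchwingerFamily.toLabelled S').HasLinearGrowth := hasLinearGrowth_pullBack hOS.2.2.1 R
  have hsym' : (SchwingerFamily.toLabelled S').IsSymmetric := isSymmetric_pullBack hOS.2.2.2.2.1 R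
  -- nonnegativity bookkeeping
  have hMg0 : 0 ≤ Mg := (integral_nonneg fun _ => norm_nonneg _).trans hMg
  have hMh0 : 0 ≤ Mh := (integral_nonneg fun _ => norm_nonneg _).trans hMh
  have hMh'0 : 0 ≤ Mh' := (norm_nonneg _).trans (hMh' 0)
  have hr0 : 0 ≤ u ^ (-μ') + v ^ (-μ') := add_nonneg (Real.rpow_nonneg hu.le _) (Real.rpow_nonneg hv.le _)
  -- THE 45° ROW (operator form) for the family `S'`, constant `2048·C`
  suffices hrow' : ∀ (m : ℕ) (Gm : 𝓢((Fin m → E4), ℂ)) (hGm : IsTimeOrdered Gm)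
      (hXGm : IsTimeOrdered
        (f₁.appendTensor (translateMulti ((2 * u + v) • EuclideanSpace.single 0 1) Gm))),
      ‖h'.fieldVec (1 + m) (fun _ => ())
          (f₁.appendTensor (translateMulti ((2 * u + v) • EuclideanSpace.single 0 1) Gm)) hXGm‖ ≤
        (2048 * C * Mg * (Mh + Mh') * (u ^ (-μ') + v ^ (-μ'))) * ‖h'.fieldVec m (fun _ => ()) Gm hGm‖ by
    intro n W hW hFW
    exact hrow' n W hW hFW
  -- narrowness scale and the narrow-class constant
  obtain ⟨w, hw⟩ : ∃ w : ℝ, w = min u v / 4 := ⟨_, rfl⟩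
  have hmin : 0 < min u v := lt_min hu hv
  have hw0 : 0 < w := by rw [hw]; positivity
  have h4wu : 4 * w ≤ u := by rw [hw]; linarith [min_le_left u v]
  have h4wv : 4 * w ≤ v := by rw [hw]; linarith [min_le_right u v]
  obtain ⟨L, hL⟩ : ∃ L : ℝ, L = 64 * C * 16 * (u ^ (-μ') + v ^ (-μ')) := ⟨_, rfl⟩
  have hL0 : 0 ≤ L := by rw [hL]; positivity
  -- THE NARROW CLASS: insertions with `|x₁'| ≤ w`
  have hnarrow : ∀ (f₁n : 𝓢((Fin 1 → E4), ℂ)) (gn hhn : ℝ × ℝ → ℂ) (Mgn Mhn Mh'n : ℝ),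
      (∀ x : Fin 1 → E4, f₁n x = gn (x 0 0, x 0 1) * hhn (x 0 2, x 0 3)) →
      (∀ p : ℝ × ℝ, gn p ≠ 0 → u ≤ p.1 ∧ p.1 ≤ 2 * u ∧ |p.2| ≤ w) →
      Integrable gn → (∫ p, ‖gn p‖) ≤ Mgn → Integrable hhn → (∫ p, ‖hhn p‖) ≤ Mhn →
      (∀ p, ‖hhn p‖ ≤ Mh'n) →
      ∀ (n : ℕ) (W : 𝓢((Fin n → E4), ℂ)) (hW : IsTimeOrdered W)
        (hFW : IsTimeOrdered (f₁n.appendTensor (translateMulti ((2 * u + v) • EuclideanSpace.single 0 1) W))),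
        ‖h'.fieldVec (1 + n) (fun _ => ())
            (f₁n.appendTensor (translateMulti ((2 * u + v) • EuclideanSpace.single 0 1) W)) hFW‖ ≤
          L * Mgn * (Mhn + Mh'n) * ‖h'.fieldVec n (fun _ => ()) W hW‖ := by
    intro f₁n gn hhn Mgn Mhn Mh'n hf₁n hgn hgin hMgn hhin hMhn hMh'n
    have hwin : tsupport (f₁n : (Fin 1 → E4) → ℂ) ⊆ {x | u ≤ x 0 0 ∧ x 0 0 ≤ 2 * u} :=
      tsupport_subset_window hf₁n fun p hp => ⟨(hgn p hp).1, (hgn p hp).2.1⟩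
    have hMgn0 : 0 ≤ Mgn := (integral_nonneg fun _ => norm_nonneg _).trans hMgn
    have hMhn0 : 0 ≤ Mhn := (integral_nonneg fun _ => norm_nonneg _).trans hMhn
    have hMh'n0 : 0 ≤ Mh'n := (norm_nonneg _).trans (hMh'n 0)
    obtain ⟨Λs, hΛs⟩ : ∃ Λs : ℝ, Λs = 64 * C * Mgn * (Mhn + Mh'n) * (16 * (u ^ (-μ') + v ^ (-μ'))) :=
      ⟨_, rfl⟩
    have hΛs0 : 0 ≤ Λs := by rw [hΛs]; positivity
    have hLeq : L * Mgn * (Mhn + Mh'n) = Λs := by rw [hL, hΛs]; ring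
    -- the tilted period and its iterates (stub TS)
    obtain ⟨Q, hQ⟩ : ∃ Q : (Σ m : ℕ, 𝓢((Fin m → E4), ℂ)) → (Σ m : ℕ, 𝓢((Fin m → E4), ℂ)),
        Q = fun Gσ => ⟨1 + (1 + Gσ.1), translateMulti ((2 * u + v) • R (EuclideanSpace.single 0 1))
          ((linActMulti R (osAdjoint f₁n)).appendTensor
            ((linActMulti R f₁n).appendTensor
              (translateMulti ((2 * u + v) • R (EuclideanSpace.single 0 1)) Gσ.2)))⟩ := ⟨_, rfl⟩
    have hTSd := stub_tiltedStep S₁ h R hRq μ' (64 * C) hμ'0 hμ'4.le (by positivity) hGW' u v w hu hv hw0 hu1 hv1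
      h4wu h4wv f₁n gn hhn Mgn Mhn Mh'n hf₁n hgn hgin hMgn hhin hMhn hMh'n Q hQ
    have hiter : ∀ (N : ℕ) (x : Σ m : ℕ, 𝓢((Fin m → E4), ℂ)), IsTimeOrdered x.2 →
        IsTimeOrdered (Q^[N] x).2 ∧ ∀ (hx : IsTimeOrdered x.2) (hQN : IsTimeOrdered (Q^[N] x).2),
          ‖h.fieldVec (Q^[N] x).1 (fun _ => ()) (Q^[N] x).2 hQN‖ ≤
            (Λs ^ 2) ^ N * ‖h.fieldVec x.1 (fun _ => ()) x.2 hx‖ := by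
      intro N
      induction N with
      | zero =>
        intro x hx
        refine ⟨hx, fun hx' hQN => ?_⟩
        rw [pow_zero, one_mul]
        exact le_of_eq rfl
      | succ N ih =>
        intro x hx
        have h1 := hTSd x.1 x.2 hx
        have hQx : IsTimeOrdered (Q x).2 := h1.1
        have h2 := ih (Q x) hQx
        rw [Function.iterate_succ_apply]
        refine ⟨h2.1, fun hx' hQN => ?_⟩
        have h12 : ‖h.fieldVec (Q x).1 (fun _ => ()) (Q x).2 hQx‖ ≤
            Λs ^ 2 * ‖h.fieldVec x.1 (fun _ => ()) x.2 hx'‖ := by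
          rw [hΛs]; exact h1.2 hx' hQx
        calc ‖h.fieldVec (Q^[N] (Q x)).1 (fun _ => ()) (Q^[N] (Q x)).2 hQN‖
            ≤ (Λs ^ 2) ^ N * ‖h.fieldVec (Q x).1 (fun _ => ()) (Q x).2 hQx‖ := h2.2 hQx hQN
          _ ≤ (Λs ^ 2) ^ N * (Λs ^ 2 * ‖h.fieldVec x.1 (fun _ => ()) x.2 hx'‖) :=
              mul_le_mul_of_nonneg_left h12 (by positivity)
          _ = (Λs ^ 2) ^ (N + 1) * ‖h.fieldVec x.1 (fun _ => ()) x.2 hx'‖ := by ring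
    -- the chain step of the 45° family for `f₁n`, and the class of its strict cone chains
    obtain ⟨P', hP'⟩ : ∃ P' : (Σ m : ℕ, 𝓢((Fin m → E4), ℂ)) → (Σ m : ℕ, 𝓢((Fin m → E4), ℂ)),
        P' = fun Gσ => ⟨1 + (1 + Gσ.1), translateMulti ((2 * u + v) • EuclideanSpace.single 0 1)
          ((osAdjoint f₁n).appendTensor
            (f₁n.appendTensor (translateMulti ((2 * u + v) • EuclideanSpace.single 0 1) Gσ.2)))⟩ :=
      ⟨_, rfl⟩
    obtain ⟨𝒯, h𝒯def⟩ : ∃ 𝒯 : Set (Σ m : ℕ, 𝓢((Fin m → E4), ℂ)), 𝒯 = {x | IsTimeOrdered x.2 ∧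
        tsupport (x.2 : (Fin x.1 → E4) → ℂ) ⊆
          {y | (∀ i, |y i 1| < y i 0) ∧ ∀ i j, i < j → |y j 1 - y i 1| < y j 0 - y i 0}} := ⟨_, rfl⟩
    have hmem : ∀ x : Σ m : ℕ, 𝓢((Fin m → E4), ℂ), x ∈ 𝒯 ↔ (IsTimeOrdered x.2 ∧
        tsupport (x.2 : (Fin x.1 → E4) → ℂ) ⊆
          {y | (∀ i, |y i 1| < y i 0) ∧ ∀ i j, i < j → |y j 1 - y i 1| < y j 0 - y i 0}) := by
      intro x; rw [h𝒯def]; rfl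
    have h𝒯 : ∀ x ∈ 𝒯, IsTimeOrdered x.2 := fun x hx => ((hmem x).1 hx).1
    -- density of the strict cone chains of the 45° frame (landed `stub_density`, crux 9664)
    have hdense : Dense ((Submodule.span ℂ
        {ψ : h'.Hilbert | ∃ (x : Σ m : ℕ, 𝓢((Fin m → E4), ℂ)) (hx : x ∈ 𝒯),
          ψ = h'.fieldVec x.1 (fun _ => ()) x.2 (h𝒯 x hx)} : Submodule ℂ h'.Hilbert) : Set h'.Hilbert) := by
      have hd := stub_density S' hlg' hsym' h'
      have hset : {ψ : h'.Hilbert | ∃ (x : Σ m : ℕ, 𝓢((Fin m → E4), ℂ)) (hx : x ∈ 𝒯),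
            ψ = h'.fieldVec x.1 (fun _ => ()) x.2 (h𝒯 x hx)} =
          {ψ : h'.Hilbert | ∃ (m : ℕ) (G : 𝓢((Fin m → E4), ℂ)) (hG : IsTimeOrdered G),
            tsupport (G : (Fin m → E4) → ℂ) ⊆
              {x | (∀ i, |x i 1| < x i 0) ∧ ∀ i j, i < j → |x j 1 - x i 1| < x j 0 - x i 0} ∧
            ψ = h'.fieldVec m (fun _ => ()) G hG} := by
        ext ψ
        constructor
        · rintro ⟨x, hx, rfl⟩
          exact ⟨x.1, x.2, ((hmem x).1 hx).1, ((hmem x).1 hx).2, rfl⟩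
        · rintro ⟨m, G, hG, hc, rfl⟩
          exact ⟨⟨m, G⟩, (hmem _).2 ⟨hG, hc⟩, rfl⟩
      rw [hset]
      exact hd
    -- pairwise chain bounds (stubs TR + TS), then the sum engine (stub SE)
    have hbound : ∀ (k : ℕ) (Gf : Fin k → Σ m : ℕ, 𝓢((Fin m → E4), ℂ)) (hGf : ∀ i, Gf i ∈ 𝒯)
        (hXG : ∀ i, IsTimeOrdered
          (f₁n.appendTensor (translateMulti ((2 * u + v) • EuclideanSpace.single 0 1) (Gf i).2)))
        (c : Fin k → ℂ),
        ‖∑ i, c i • h'.fieldVec (1 + (Gf i).1) (fun _ => ())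
            (f₁n.appendTensor (translateMulti ((2 * u + v) • EuclideanSpace.single 0 1) (Gf i).2)) (hXG i)‖ ≤
          Λs * ‖∑ i, c i • h'.fieldVec (Gf i).1 (fun _ => ()) (Gf i).2 (h𝒯 _ (hGf i))‖ := by
      intro k Gf hGf hXG c
      have hGf' := fun i => (hmem _).1 (hGf i)
      have hTRi := fun i => stub_tiltedChainReading S₁ h R hRq u v f₁n P' Q hP' hQ (Gf i).1 (Gf i).2 (hGf' i).1 (hGf' i).2
      obtain ⟨a, ha⟩ : ∃ a : Fin k → ℝ, a = fun i =>
        max ‖h.fieldVec (Gf i).1 (fun _ => ())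
              (linActMulti (((timeReflection 4).trans R).trans (timeReflection 4)) (Gf i).2) (hTRi i).2.1‖
            ‖h.fieldVec (Gf i).1 (fun _ => ()) (linActMulti R (Gf i).2) (hTRi i).1‖ := ⟨_, rfl⟩
      have haA : ∀ i, ‖h.fieldVec (Gf i).1 (fun _ => ())
          (linActMulti (((timeReflection 4).trans R).trans (timeReflection 4)) (Gf i).2) (hTRi i).2.1‖ ≤ a i :=
        fun i => by rw [ha]; exact le_max_left _ _
      have haW : ∀ i, ‖h.fieldVec (Gf i).1 (fun _ => ()) (linActMulti R (Gf i).2) (hTRi i).1‖ ≤ a i :=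
        fun i => by rw [ha]; exact le_max_right _ _
      have ha0 : ∀ i, 0 ≤ a i := fun i => (norm_nonneg _).trans (haA i)
      refine stub_sumEngine S' h' u v hu hv f₁n hwin P' hP' Λs hΛs0 k Gf (fun i => (hGf' i).1) hXG a ha0 ?_ c
      intro i j N
      obtain ⟨_, hid⟩ := (hTRi i).2.2.2 (Gf j).1 (Gf j).2 (hGf' j).1 (hGf' j).2 N
      have hQN := hiter N ⟨(Gf j).1, linActMulti R (Gf j).2⟩ (hTRi j).1
      have hident := hid (hTRi i).2.1 hQN.1
      have hSj : (⟨(Gf j).1, (Gf j).2⟩ : Σ m : ℕ, 𝓢((Fin m → E4), ℂ)) = Gf j := Sigma.eta _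
      rw [hSj] at hident
      change ‖S₁ ((Gf i).1 + (P'^[N] (Gf j)).1)
        (linActMulti R ((osAdjoint (Gf i).2).appendTensor (P'^[N] (Gf j)).2))‖ ≤ _
      rw [hident]
      calc ‖⟪h.fieldVec (Gf i).1 (fun _ => ())
                (linActMulti (((timeReflection 4).trans R).trans (timeReflection 4)) (Gf i).2) (hTRi i).2.1,
              h.fieldVec (Q^[N] ⟨(Gf j).1, linActMulti R (Gf j).2⟩).1 (fun _ => ())
                (Q^[N] ⟨(Gf j).1, linActMulti R (Gf j).2⟩).2 hQN.1⟫_ℂ‖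
          ≤ ‖h.fieldVec (Gf i).1 (fun _ => ())
                (linActMulti (((timeReflection 4).trans R).trans (timeReflection 4)) (Gf i).2) (hTRi i).2.1‖ *
              ‖h.fieldVec (Q^[N] ⟨(Gf j).1, linActMulti R (Gf j).2⟩).1 (fun _ => ())
                (Q^[N] ⟨(Gf j).1, linActMulti R (Gf j).2⟩).2 hQN.1‖ := norm_inner_le_norm _ _
        _ ≤ a i * ((Λs ^ 2) ^ N * a j) := by
            refine mul_le_mul (haA i) ?_ (norm_nonneg _) (ha0 i)
            refine (hQN.2 (hTRi j).1 hQN.1).trans ?_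
            exact mul_le_mul_of_nonneg_left (haW j) (by positivity)
        _ = a i * a j * Λs ^ (2 * N) := by rw [pow_mul]; ring
    -- descent to every field vector (stub DE)
    have hDEd := stub_descent S' h' u v hu hv f₁n hwin Λs hΛs0 𝒯 h𝒯 hdense hbound
    intro nn W hW hFW
    rw [hLeq]
    exact hDEd nn W hW hFW
  -- all insertions (stub NR)
  intro m Gm hGm hXGm
  have key := stub_narrowReduction S' h' u v w L hu hv hw0 hL0 hnarrow f₁ g hh Mg Mh Mh' hf₁ hg hgi hMg hhi hMh hMh'
    m Gm hGm hXGm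
  calc _ ≤ _ := key
    _ = _ := by rw [hL]; ring

/-- **The crux is its axis row**: `CurvatureSandwichBound ↔` (for every `G, r, sch, S₁` with `W1`, the eight frames,
the cone and the soft kernel, the `e₀`-frame rows `SandwichRows S₁`).  `→` drops the 45° conjunct; `←` is the frame
transfer `sandwichRows_quarterTurn_of_sandwichRows` (OS package and translations from `W1`). -/
theorem curvatureSandwichBound_iff_axisRows :
    Summit.QuantumFields.YangMills.Theses.IsotropyFromPowerCounting.CurvatureSandwichBound ↔
      ∀ (G : Type) [Group G] [TopologicalSpace G] [IsTopologicalGroup G] [CompactSpace G]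
        [MeasurableSpace G] [BorelSpace G], IsCompactSimpleLieGroup G →
        ∀ (r : LatticeRep G) (sch : SpeciesScheme (YMSpecies G)) (S₁ : SchwingerFamily E4),
          W1 r sch S₁ → EightFrameRP S₁ → PlanarCone S₁ → SoftKernel S₁ → SandwichRows S₁ := by
  rw [curvatureSandwichBound_iff]
  refine ⟨fun hS G _ _ _ _ _ _ hG r sch S₁ hW h8 hC hK => (hS G hG r sch S₁ hW h8 hC hK).1,
    fun hA G _ _ _ _ _ _ hG r sch S₁ hW h8 hC hK => ⟨hA G hG r sch S₁ hW h8 hC hK, fun R hR => ?_⟩⟩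
  exact sandwichRows_quarterTurn_of_sandwichRows S₁ hW.2.1 hW.2.2.1 (hA G hG r sch S₁ hW h8 hC hK) R hR

end Summit.QuantumFields.YangMills.Theorems.CurvatureSandwichBound.Sketch

end
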